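import Literature.IUT.HodgeTheaters.StableCurveTemperedDataOfSpecialFibreSec2OneCallA3Prime
import HarnessLib

/-!
# The §2 one-call's last law is the LEVEL-`j` CONTENT of [IUTchI] Prop. 2.4 (ii): (A3′)_j ⟸ `LevelObservation` at level `j`

S. Mochizuki, *Inter-universal Teichmüller theory I*, kurims manuscript (May 2020), §2, proof of Prop. 2.4 (ii), p. 50
l. 52 – p. 51 l. 13 ("this *observation* … applied to the quotients `Π^tp_X ↠ Π^tp_X/Ker(J ↠ Π^tp_{𝔾*_J})`")
[cite: Mochizuki2012, Prop 2.4(ii) pp.50-51] (D-0012 claim key, status disputed; the content of this file is elementary group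
theory plus bookkeeping and takes no side).

PROOF-ONLY note (abc-iut cell, seat abc-iut-L5-t11 gen 15, row «SEC2-A3-TRICHOTOMY-TRANSFER» part 3) over abc-iut-w4-d058
gen 11's p500641; no definition, no instance, no notation, no new `Prop` fact.  CENSUS SHARPENING for the one binder of
IUTchI:Cor2.5 still counted as a LAW (abc-iut-L5-lead RULINGS #119 (3)), in its E-free spelling (A3′)_j of p500641
(«a `Π̂_j`-conjugate of the image `Λ̄_j` of a compact open-image `Λ ≤ Π^temp_{X_K}` inside `g·ι_j(D_v)·g⁻¹ ∩ h·ι_j(D_w)·h⁻¹`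
forces `g⁻¹h ∈ ι_j(Π^tp_j)`»): **(A3′)_j FOLLOWS from abc-iut-L5-t1/w4-d063's typed level-`j` statement
`Prop24QTower.LevelObservation`** — "(OBS)": an element of `Π̂_j` conjugating `Λ̄_j` into `ι_j(Π^tp_j)` is tempered — for the
genuine quotient tower, for EVERY decomposition data `Dd j`, with NO input from [SemiAnbd] Thm 5.4 (i): `g⁻¹γ` and `h⁻¹γ`
conjugate `Λ̄_j` into `ι_j(D_v)`, `ι_j(D_w) ≤ ι_j(Π^tp_j)`, so both are tempered by (OBS), hence so is
`g⁻¹h = (g⁻¹γ)(h⁻¹γ)⁻¹`.  Conversely the lineage DERIVES (OBS) from `hI_j` ([SemiAnbd] Thm 5.4 (i)) + the (A3-arith)_j law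
(+ (RF)_j, derived) — abc-iut-L5-t11 gen 7/8 `prop24ii_ofPiData_of_arithStatementI_canonical(_of_RF)` /
`Prop24QTower.levelObservation_of_arithStatementI`.  So, modulo Thm 5.4 (i) BY NAME, the last law is EXACTLY the level-`j`
content of the node Prop 2.4 (ii): no re-typing on the L5 side can weaken it further; it is discharged precisely when print's
(OBS) is (FACT-class: [AbsTopII] Prop 1.3 (iv) / [NodNon] Prop 3.9 (i) at the arithmetic level data — GAP-LEDGER
G-L5t11g15-1 for its print-faithful trichotomy form, p506978).

HONEST TAGS.  Nothing here proves (OBS), (A3′)_j or the trichotomy at a genuine datum; CONDITIONAL as labelled; typed ≠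
inhabited ≠ discharged; nothing here asserts that abc is proved or refuted, and nothing here bears on [IUTchIII] Cor. 3.12.
-/

noncomputable section

namespace Literature.IUT.HodgeTheaters

open _root_.Topology
open scoped Pointwise
open Literature.AnabelianGeometry.SemiGraphs Literature.AnabelianGeometry.SemiGraphs.ProfiniteSemiGraph

namespace StableCurveTemperedData

namespace OfSpecialFibre

variable {p : ℕ} [Fact p.Prime] (X : TemperedCurve p)
  (d : X.GroupLevelData) (T : SpecialFibreTower X.DeltaTemp)
  (Sigma SigmaHat : Set ℕ) (hsub : Sigma ⊆ SigmaHat) (hne : Set.Nonempty Sigma)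
  (hprime : ∀ q ∈ SigmaHat, q.Prime)
  (S : SpecialFibreData (X.toTemperedArithmeticGroup d)) (h36 : S.Gc.Prop36Hypotheses)
  (hp : p ∉ Sigma) (TpH : Subgroup S.chart.G)
  (HatH : Subgroup (TemperedGraphGroupData.exists_completion_of_prop36 S.Gc h36 S.chart).choose)
  (hle : TpH.map (TemperedGraphGroupData.exists_completion_of_prop36 S.Gc h36
    S.chart).choose_spec.choose.toMonoidHom ≤ HatH)
  (cuspMeetsH : {x : X.Pt // X.IsCusp x} → Prop)

/-- **(A3′)_j ⟸ (OBS)_j**: for the genuine quotient tower over `P` and ANY level-`j` decomposition data `Dd j`, abc-iut-L5-t1's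
typed level statement `Prop24QTower.LevelObservation` ("an element of `Π̂_j` conjugating the image of a compact open-image
`Λ ≤ Π^temp_{X_K}` into `ι_j(Π^tp_j)` is tempered", [IUTchI] p. 50 l. 52 – p. 51 l. 6) implies abc-iut-w4-d058's E-free law
(A3′)_j verbatim (p500641): if `γΛ̄_jγ⁻¹ ≤ g·ι_j(D_v)·g⁻¹` and `≤ h·ι_j(D_w)·h⁻¹` then `g⁻¹γ`, `h⁻¹γ` conjugate `Λ̄_j` into
`ι_j(Π^tp_j)`, so are tempered by (OBS), and `g⁻¹h = (g⁻¹γ)(h⁻¹γ)⁻¹ ∈ ι_j(Π^tp_j)`.  No [SemiAnbd] Thm 5.4 input.  CONDITIONAL on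
the displayed `hLev`. [cite: Mochizuki2012, Prop 2.4(ii) pp.50-51] [claim: Mochizuki2012, status: disputed] -/
theorem A3prime_of_levelObservation (P : SpecialFibreTower.PiData X d S T) {V B : ℕ → Type*}
    (Dd : ∀ j, DecompositionData ((qTowerOfSpecialFibreTower X T d S h36 Sigma SigmaHat hsub hne hprime hp TpH HatH hle cuspMeetsH P.admKer_normal_pi).Q j).Tp (V j) (B j))
    (hLev : (qTowerOfSpecialFibreTower X T d S h36 Sigma SigmaHat hsub hne hprime hp TpH HatH hle cuspMeetsH P.admKer_normal_pi).LevelObservation) :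
    ∀ (j : ℕ) (Λ : Subgroup X.PiTemp), IsCompact (Λ : Set X.PiTemp) → Λ ≠ ⊥ →
      IsOpen (Λ.map X.augGK.toMonoidHom : Set X.GK) →
      ∀ (v w : V j) (g h γ : ((qTowerOfSpecialFibreTower X T d S h36 Sigma SigmaHat hsub hne hprime hp TpH HatH hle cuspMeetsH P.admKer_normal_pi).Q j).Hat),
        MulAut.conj γ • Λ.map (((qTowerOfSpecialFibreTower X T d S h36 Sigma SigmaHat hsub hne hprime hp TpH HatH hle cuspMeetsH P.admKer_normal_pi).qhat j).comp X.toHat.toMonoidHom) ≤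
            MulAut.conj g • ((Dd j).vertGp v).map ((qTowerOfSpecialFibreTower X T d S h36 Sigma SigmaHat hsub hne hprime hp TpH HatH hle cuspMeetsH P.admKer_normal_pi).Q j).ι →
        MulAut.conj γ • Λ.map (((qTowerOfSpecialFibreTower X T d S h36 Sigma SigmaHat hsub hne hprime hp TpH HatH hle cuspMeetsH P.admKer_normal_pi).qhat j).comp X.toHat.toMonoidHom) ≤
            MulAut.conj h • ((Dd j).vertGp w).map ((qTowerOfSpecialFibreTower X T d S h36 Sigma SigmaHat hsub hne hprime hp TpH HatH hle cuspMeetsH P.admKer_normal_pi).Q j).ι →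
          g⁻¹ * h ∈ ((qTowerOfSpecialFibreTower X T d S h36 Sigma SigmaHat hsub hne hprime hp TpH HatH hle cuspMeetsH P.admKer_normal_pi).Q j).ι.range := by
  intro j Λ hΛc hΛ1 hΛo v w g h γ hgv hhw
  -- (OBS) applied to `x⁻¹γ` whenever `γΛ̄γ⁻¹ ≤ x·ι_j(K)·x⁻¹` for some `K ≤ Π^tp_j`
  have key : ∀ (x : ((qTowerOfSpecialFibreTower X T d S h36 Sigma SigmaHat hsub hne hprime hp TpH HatH hle cuspMeetsH P.admKer_normal_pi).Q j).Hat) (K : Subgroup ((qTowerOfSpecialFibreTower X T d S h36 Sigma SigmaHat hsub hne hprime hp TpH HatH hle cuspMeetsH P.admKer_normal_pi).Q j).Tp),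
      MulAut.conj γ • Λ.map (((qTowerOfSpecialFibreTower X T d S h36 Sigma SigmaHat hsub hne hprime hp TpH HatH hle cuspMeetsH P.admKer_normal_pi).qhat j).comp X.toHat.toMonoidHom) ≤
          MulAut.conj x • K.map ((qTowerOfSpecialFibreTower X T d S h36 Sigma SigmaHat hsub hne hprime hp TpH HatH hle cuspMeetsH P.admKer_normal_pi).Q j).ι →
        x⁻¹ * γ ∈ ((qTowerOfSpecialFibreTower X T d S h36 Sigma SigmaHat hsub hne hprime hp TpH HatH hle cuspMeetsH P.admKer_normal_pi).Q j).ι.range := by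
    intro x K hx
    refine hLev j Λ hΛc hΛ1 hΛo (x⁻¹ * γ) ?_
    intro l hl
    have hq : (((qTowerOfSpecialFibreTower X T d S h36 Sigma SigmaHat hsub hne hprime hp TpH HatH hle cuspMeetsH P.admKer_normal_pi).qhat j).comp X.toHat.toMonoidHom) l ∈ Λ.map (((qTowerOfSpecialFibreTower X T d S h36 Sigma SigmaHat hsub hne hprime hp TpH HatH hle cuspMeetsH P.admKer_normal_pi).qhat j).comp X.toHat.toMonoidHom) :=
      Subgroup.mem_map_of_mem _ hl
    have hmem := hx (Subgroup.smul_mem_pointwise_smul _ (MulAut.conj γ) _ hq)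
    rw [Subgroup.mem_pointwise_smul_iff_inv_smul_mem] at hmem
    obtain ⟨y, -, hy⟩ := hmem
    refine MonoidHom.mem_range.mpr ⟨y, ?_⟩
    change ((qTowerOfSpecialFibreTower X T d S h36 Sigma SigmaHat hsub hne hprime hp TpH HatH hle cuspMeetsH P.admKer_normal_pi).Q j).ι y = x⁻¹ * γ * (((qTowerOfSpecialFibreTower X T d S h36 Sigma SigmaHat hsub hne hprime hp TpH HatH hle cuspMeetsH P.admKer_normal_pi).qhat j) (X.toHat.toMonoidHom l)) * (x⁻¹ * γ)⁻¹
    rw [hy]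
    simp only [MulAut.smul_def, MulAut.conj_inv_apply, MulAut.conj_apply, MonoidHom.coe_comp, Function.comp_apply,
      mul_inv_rev, inv_inv, mul_assoc]
  have hg : g⁻¹ * γ ∈ ((qTowerOfSpecialFibreTower X T d S h36 Sigma SigmaHat hsub hne hprime hp TpH HatH hle cuspMeetsH P.admKer_normal_pi).Q j).ι.range := key g _ hgv
  have hh : h⁻¹ * γ ∈ ((qTowerOfSpecialFibreTower X T d S h36 Sigma SigmaHat hsub hne hprime hp TpH HatH hle cuspMeetsH P.admKer_normal_pi).Q j).ι.range := key h _ hhw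
  have hgh : g⁻¹ * h = (g⁻¹ * γ) * (h⁻¹ * γ)⁻¹ := by group
  rw [hgh]
  exact mul_mem hg (inv_mem hh)

end OfSpecialFibre

end StableCurveTemperedData

end Literature.IUT.HodgeTheaters

end
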